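import Summits.BirchSwinnertonDyer.Rank1Residual.X2.GreenbergVatsalAnalyticTransfer
import Literature.NumberTheory.EllipticCurves.GreenbergVatsal2000.MultiplicativeLambda
import Literature.NumberTheory.EllipticCurves.SelmerInftyTorsionFiniteProofs
import Literature.NumberTheory.EllipticCurves.HasseWeilGoodReduction
import HarnessLib

/-!
# Class X2a, GV CASE 1: the flag's named fact `lambda_muAnal_multiplicative_of_gvPar` RESTRICTED
# TO A RAMIFIED-EVEN LINE, derived in the kernel from the cell's registered facts + TWO DISPLAYED
# HYPOTHESIS SHAPES (GV p. 30 lifting; GV §3 Thm. (3.11) + (28) + p. 43) — the successor's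
# reading-facts, word for word (cell `b2b-bsdres`, unit `b2b-bsdres-eisenstein-p2`, gen 17)

HONEST FRAMING (run/shared/lean/b2b/bsd-rank1-residual/, verbatim in every file): the goal of the
cell is to DELETE the COMBINATION-SHAPED residual classes of the Birch–Swinnerton-Dyer formula for
ALL analytic-rank `≤ 1` elliptic curves over `ℚ` — "full BSD formula for every rank `≤ 1` curve in
class `C`" assembled STRICTLY from published theorems — so that the rank-`≤ 1` remainder becomes
exactly the CONSTRUCTION-SHAPED classes, which are TYPED (missing-input `Prop`s), NOT attempted.
This is not "finishing BSD". Research route; NO CLAIM BEYOND STATED CLASSES; nothing here changes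
a label (X2a stays "CLOSED PUB* modulo `GV00-mult-asserted`" until the referee rules). THEOREMS
ONLY (no `def`, no named fact, no `sorry`): the two printed inputs that are not (yet) Literature
facts are HYPOTHESES `hLift`, `hAn` whose types are spelled out in full — they assert nothing.

WHAT (X2-GAP §22.3, successor item (ii)). `caseOne_clause_of_shapes` has as CONCLUSION the body of
`GreenbergVatsal2000.lambda_muAnal_multiplicative_of_gvPar` (file
`GreenbergVatsal2000/MultiplicativeLambda.lean`) after its binders — the split clause
(`∀ L, IsSplitMultPAdicLFunctionOf f p L → ∀ b, ι b = ϖ·L → HasUnitContent b ∧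
ord_T(b mod p) = ord_T(T·f_E mod p)`) and the non-split clause — for the SAME data
`(W, p, κ, γ, f, D, ϖ, f_E)`, with the hypothesis `GVPar W p` replaced by its FIRST CASE: a rational
line `Φ₀ ≤ E[p]` ramified at `p` and even. Its HYPOTHESES are:
* the registered algebraic facts A40/A41 (`hT`, `hT'`: Tate uniformisation), A133 (`hA`), A135
  (`hB`), A137 (`hF`) and Greenberg 1999 Prop. 5.10 (`hG`, A-fact
  `Greenberg1999.prop510_isTorsion_hasUnitContent_of_gvPar`: `X` torsion with `μ = 0` under (GV));
* `hLift` — the SHAPE of GV p. 30 ("`H²(ℚ_Σ/ℚ_∞, Φ) = 0`" ⇐ Ferrero–Washington + Prop. (2.5) +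
  [Gre99] Prop. 4; `E`-independent, character-theoretic) in the operational form gen 16 consumes:
  every class of `S^{Σ₀}_{E[p]/Φ₀}(ℚ_∞)` lifts to `H¹(ℚ_Σ/ℚ_∞, E[p])`, for every `Σ₀ ∌ p` finite
  containing the bad primes `≠ p`;
* `hAn` — the SHAPE of GV §3 at `χ = 1` (Thm. (3.11) `L_{Σ₀}(E/ℚ,T) ≡ u·L(G,T) (mod π)`, whose proof
  PRINTS the `p ∣ M` paragraph, p. 43; (28) `L(G,T) = L_{Σ₀}(C,T)·L_{Σ₀}(D,T)` with Ferrero–Washington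
  "the `μ`-invariant of `L(G,T)` is zero because that is true for each factor in (28)"; and "the
  `λ`-invariant of `L(G, T)` is equal to `λ_{φ,Σ₀} + λ_{ψ,Σ₀}`. The two terms are the `O`-coranks of
  `S^{Σ₀}_C(ℚ_∞)` and `S^{Σ₀}_D(ℚ_∞)`", which pp. 28–29 (Props. (2.6)/(2.8), Cor. (2.3)) identify
  with `dim H¹(ℚ_Σ/ℚ_∞, Φ)` and `dim S^{Σ₀}_Ψ(ℚ_∞)`): for every `b ∈ Λ` with `ι b = ϖ·L(E/ℚ,T)`
  the non-primitive element `b·∏_{ℓ∈Σ₀}𝒫_ℓ` (`= ϖ·L_{Σ₀}(E/ℚ,T)` under `ι`) has unit content and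
  `p^{ord_T(b·∏𝒫 mod p)} = #H¹(ℚ_Σ/ℚ_∞, Φ₀) · #S^{Σ₀}_{E[p]/Φ₀}(ℚ_∞)`.
The PROOF chooses `Σ₀ :=` the bad places not above `p` (finite: `eventually_hasGoodReductionAt`),
gets `Module.Finite` (`SelmerDualData.module_finite_of_isCyclotomic`), torsion and `μ(X) = 0`
(Prop. 5.10 via `mu_eq_zero_iff_hasUnitContent`), and applies gen 17's
`GreenbergVatsalAnalyticTransfer.unitContent_and_order_eq_of_card_eq_of_{split,not_split}`.

So: once the lit seat files `hLift`'s and `hAn`'s types as Literature reading-facts (verbatim GV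
p. 30 / §3), CASE 1 of `lambda_muAnal_multiplicative_of_gvPar` is a kernel THEOREM over registered
facts. CASE 2 (line unramified at `p` and odd) is not covered (GV p. 28: isogeny reduction via
Schneider; or the twin devissage) — X2-GAP §22.6.

References: [GreenbergVatsal2000] §2 (16), pp. 28–30; §3 Thm. (3.11), (26)–(28), p. 43;
[GreenbergLNM1716] Prop. 5.10; HOME/b2b-bsdres-eisenstein-p2/X2-GAP.md §22.
-/

set_option autoImplicit false

noncomputable section

open scoped Classical AddSubgroup MatrixGroups ModularForm

open PowerSeries NumberField IsDedekindDomain Field WeierstrassCurve CongruenceSubgroup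
  Literature.NumberTheory.EllipticCurves Literature.NumberTheory.EllipticCurves.GreenbergVatsal2000
  Literature.NumberTheory.EllipticCurves.ModularForms
  Literature.NumberTheory.EllipticCurves.Rank1Residual
  Summit.BirchSwinnertonDyer.Rank1Residual.X2.EulerFactorAlgebra
  Summit.BirchSwinnertonDyer.Rank1Residual.X2.EulerFactorInvariants
  Summit.BirchSwinnertonDyer.Rank1Residual.X2.GreenbergVatsalAnalyticTransferCore
  Summit.BirchSwinnertonDyer.Rank1Residual.X2.GreenbergVatsalAnalyticTransfer

namespace Summit.BirchSwinnertonDyer.Rank1Residual.X2.GreenbergVatsalCaseOne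

/-- **A finite `Σ₀ ∌ p` containing every bad place `≠ p` exists** (the bad places are finite:
`WeierstrassCurve.eventually_hasGoodReductionAt`). GV p. 42: "let `Σ₀` denote any set of primes
containing all primes `l ≠ p` dividing `N`, but not including `p`". -/
theorem exists_finset_bad_not_mem (W : WeierstrassCurve ℚ) [W.IsElliptic] (p : ℕ) :
    ∃ S₀ : Finset (HeightOneSpectrum (𝓞 ℚ)),
      (∀ v ∈ S₀, ((p : ℕ) : 𝓞 ℚ) ∉ v.asIdeal) ∧
        ∀ v : HeightOneSpectrum (𝓞 ℚ), v ∉ S₀ → ((p : ℕ) : 𝓞 ℚ) ∉ v.asIdeal →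
          W.HasGoodReductionAt v := by
  have hbadfin : {v : HeightOneSpectrum (𝓞 ℚ) | ¬ W.HasGoodReductionAt v}.Finite := by
    have h := W.eventually_hasGoodReductionAt
    rwa [Filter.eventually_cofinite] at h
  refine ⟨hbadfin.toFinset.filter (fun v => ((p : ℕ) : 𝓞 ℚ) ∉ v.asIdeal),
    fun v hv => (Finset.mem_filter.mp hv).2, fun v hv hpv => ?_⟩
  by_contra hbad
  exact hv (Finset.mem_filter.mpr ⟨hbadfin.mem_toFinset.mpr hbad, hpv⟩)

/-- **CASE 1 of the flag's named fact, from registered facts + the two displayed shapes.**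
Conclusion: LITERALLY the body of `GreenbergVatsal2000.lambda_muAnal_multiplicative_of_gvPar` for the
data `(W, p, κ, γ, f, D, ϖ, f_E)`, the hypothesis `GVPar W p` being replaced by a rational line `Φ₀`
RAMIFIED at `p` and EVEN. Hypotheses: A40/A41 (`hT`, `hT'`), A133 (`hA`), A135 (`hB`), A137 (`hF`),
Greenberg 1999 Prop. 5.10 (`hG`); `hLift` = the shape of GV p. 30 (`H²(ℚ_Σ/ℚ_∞, Φ) = 0`, as the
lifting property); `hAn` = the shape of GV Thm. (3.11) + (28) + p. 43 / pp. 28–29 at `χ = 1`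
(unit content of `ϖ·L_{Σ₀}` and `p^{λ(ϖ·L_{Σ₀})} = #H¹(ℚ_Σ/ℚ_∞, Φ₀)·#S^{Σ₀}_{E[p]/Φ₀}(ℚ_∞)`). -/
theorem caseOne_clause_of_shapes
    (hT : Silverman1994_thmV53_tateUniformisation.{0})
    (hT' : Silverman1994_thmV53_corV54_tateUniformisation.{0})
    (hA : lambda_nonPrimitive_eq_add_sum_delta_multiplicative)
    (hB : datumSelmer_divisible_of_finite_torsionBy)
    (hF : datumStrictSelmer_lt_datumSelmer_of_split)
    (hG : Greenberg1999.prop510_isTorsion_hasUnitContent_of_gvPar)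
    (hLift : ∀ (W : WeierstrassCurve ℚ) [W.IsGloballyMinimal] [W.IsElliptic] (p : ℕ) [Fact p.Prime]
      (κ : ZpExtension ℚ p) (S₀ : Finset (HeightOneSpectrum (𝓞 ℚ)))
      (Φ₀ : AddSubgroup (W.geomTorsion (p : ℤ))) (hΦ : IsRationalLine W p Φ₀),
      p ≠ 2 → κ.IsCyclotomic → ¬ LineUnramifiedAt W p Φ₀ → LineEven W p Φ₀ →
      (∀ v ∈ S₀, ((p : ℕ) : 𝓞 ℚ) ∉ v.asIdeal) →
      (∀ v : HeightOneSpectrum (𝓞 ℚ), v ∉ S₀ → ((p : ℕ) : 𝓞 ℚ) ∉ v.asIdeal →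
        W.HasGoodReductionAt v) →
      ∀ s ∈ ResidualDevissageSelmer.quotSelmer κ.kerSubgroup
          (ResidualDevissageLine.lineSub Φ₀ hΦ).Quot p (↑S₀ : Set (HeightOneSpectrum (𝓞 ℚ))),
        ∃ x ∈ GreenbergVatsal2000.unramifiedOutside κ.kerSubgroup
            ↥((↥(W.geomPrimaryTorsion p))[(p : ℤ)]) p (↑S₀ : Set (HeightOneSpectrum (𝓞 ℚ))),
          ResidualDevissageSelmer.subH1 κ.kerSubgroup (ResidualDevissageLine.lineSub Φ₀ hΦ).proj
            (ResidualDevissageLine.lineSub Φ₀ hΦ).proj_smul x = s)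
    (hAn : ∀ (W : WeierstrassCurve ℚ) [W.IsGloballyMinimal] [W.IsElliptic] (p : ℕ) [Fact p.Prime]
      (κ : ZpExtension ℚ p) {N : ℕ} [NeZero N] (f : CuspForm (Gamma0 N) 2)
      (S₀ : Finset (HeightOneSpectrum (𝓞 ℚ)))
      (Φ₀ : AddSubgroup (W.geomTorsion (p : ℤ))) (hΦ : IsRationalLine W p Φ₀),
      p ≠ 2 → W.HasMultiplicativeReductionAtPrime p → κ.IsCyclotomic →
      ¬ LineUnramifiedAt W p Φ₀ → LineEven W p Φ₀ → IsNewformOf W f →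
      (∀ v ∈ S₀, ((p : ℕ) : 𝓞 ℚ) ∉ v.asIdeal) →
      (∀ v : HeightOneSpectrum (𝓞 ℚ), v ∉ S₀ → ((p : ℕ) : 𝓞 ℚ) ∉ v.asIdeal →
        W.HasGoodReductionAt v) →
      ∀ (ϖ : ℚ), (ϖ : ℝ) * W.realPeriodRat = plusPeriod f →
      ∀ (L : PowerSeries ℚ_[p]),
        (W.HasSplitMultiplicativeReductionAtPrime p → IsSplitMultPAdicLFunctionOf f p L) →
        (¬ W.HasSplitMultiplicativeReductionAtPrime p → IsMultPAdicLFunctionOf f p (-1) L) →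
      ∀ (b : IwasawaAlgebra p),
        iwasawaToPowerSeries p b = PowerSeries.C ((ϖ : ℚ) : ℚ_[p]) * L →
        HasUnitContent (b * eulerFactorProduct W p S₀) ∧
          p ^ (PowerSeries.map (PadicInt.toZMod (p := p)) (b * eulerFactorProduct W p S₀)).order.toNat =
            Nat.card (GreenbergVatsal2000.unramifiedOutside κ.kerSubgroup
                (ResidualDevissageLine.lineSub Φ₀ hΦ).Sub p (↑S₀ : Set (HeightOneSpectrum (𝓞 ℚ)))) *
              Nat.card (ResidualDevissageSelmer.quotSelmer κ.kerSubgroup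
                (ResidualDevissageLine.lineSub Φ₀ hΦ).Quot p (↑S₀ : Set (HeightOneSpectrum (𝓞 ℚ)))))
    (W : WeierstrassCurve ℚ) [W.IsElliptic] [W.IsGloballyMinimal] (p : ℕ) [Fact p.Prime]
    {κ : ZpExtension ℚ p} {γ : absoluteGaloisGroup ℚ} {N : ℕ} [NeZero N]
    {f : CuspForm (Gamma0 N) 2}
    (hp : p ≠ 2) (hmult : W.HasMultiplicativeReductionAtPrime p)
    {Φ₀ : AddSubgroup (W.geomTorsion (p : ℤ))} (hΦ : IsRationalLine W p Φ₀)
    (hram : ¬ LineUnramifiedAt W p Φ₀) (heven : LineEven W p Φ₀)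
    (hκ : κ.IsCyclotomic) (hγ : κ.IsTopGenerator γ) (hf : IsNewformOf W f)
    (D : W.SelmerDualData κ γ) (ϖ : ℚ) (hϖ : (ϖ : ℝ) * W.realPeriodRat = plusPeriod f)
    (fE : IwasawaAlgebra p) (hchar : D.charIdeal = Ideal.span {fE}) :
    (W.HasSplitMultiplicativeReductionAtPrime p →
        ∀ (L : PowerSeries ℚ_[p]), IsSplitMultPAdicLFunctionOf f p L →
        ∀ (b : IwasawaAlgebra p), iwasawaToPowerSeries p b = PowerSeries.C ((ϖ : ℚ) : ℚ_[p]) * L →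
          HasUnitContent b ∧
            (PowerSeries.map (PadicInt.toZMod (p := p)) b).order =
              (PowerSeries.map (PadicInt.toZMod (p := p)) (PowerSeries.X * fE)).order) ∧
      (¬ W.HasSplitMultiplicativeReductionAtPrime p →
        ∀ (L : PowerSeries ℚ_[p]), IsMultPAdicLFunctionOf f p (-1) L →
        ∀ (b : IwasawaAlgebra p), iwasawaToPowerSeries p b = PowerSeries.C ((ϖ : ℚ) : ℚ_[p]) * L →
          HasUnitContent b ∧
            (PowerSeries.map (PadicInt.toZMod (p := p)) b).order =
              (PowerSeries.map (PadicInt.toZMod (p := p)) fE).order) := by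
  -- the cell's standing data: Σ₀, finiteness, torsion, μ = 0
  obtain ⟨S₀, hS₀, hS⟩ := exists_finset_bad_not_mem W p
  haveI : Module.Finite (IwasawaAlgebra p) D.X :=
    WeierstrassCurve.SelmerDualData.module_finite_of_isCyclotomic W κ hκ D hγ
  have hpar : GVPar W p := ⟨Φ₀, hΦ, Or.inl ⟨hram, heven⟩⟩
  obtain ⟨hX, g, hcharg, hug⟩ := hG.of_mult W p hp hmult hpar hκ hγ D
  have hμ : D.mu = 0 := (mu_eq_zero_iff_hasUnitContent D hX hcharg).mpr hug
  have hlift := hLift W p κ S₀ Φ₀ hΦ hp hκ hram heven hS₀ hS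
  refine ⟨fun hsplit L hL b hb => ?_, fun hns L hL b hb => ?_⟩
  · have hC := hAn W p κ f S₀ Φ₀ hΦ hp hmult hκ hram heven hf hS₀ hS ϖ hϖ L (fun _ => hL)
      (fun hns => absurd hsplit hns) b hb
    exact unitContent_and_order_eq_of_card_eq_of_split W p κ S₀ hΦ hT hT' hA hB hF hκ hγ hp hsplit
      hS₀ hS D hX hμ hram heven hlift hC hchar
  · have hC := hAn W p κ f S₀ Φ₀ hΦ hp hmult hκ hram heven hf hS₀ hS ϖ hϖ L
      (fun hsplit => absurd hsplit hns) (fun _ => hL) b hb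
    exact unitContent_and_order_eq_of_card_eq_of_not_split W p κ S₀ hΦ hT' hA hB hκ hγ hp hmult hns
      hS₀ hS D hX hμ hram heven hlift hC hchar

end Summit.BirchSwinnertonDyer.Rank1Residual.X2.GreenbergVatsalCaseOne

end
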